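import Literature.MathematicalPhysics.QuantumFieldTheory.Balaban1983to89.B8Eq138LandauZd
import Literature.MathematicalPhysics.QuantumFieldTheory.Balaban1983to89.B8Thm2SetupTorus
import Literature.MathematicalPhysics.QuantumFieldTheory.Balaban1983to89.Node00.OpsYGauge

/-!
# `Balaban1983to89.B9B8CarrierDictionary` — JUNCTION J-A, FILE 1: the EXACT fine-lattice dictionary between the [Balaban1985RegularSpaces] knit's
# periodic-`ℤᵈ` carrier (`B7Prop1Explicit.Site d`, letters `covDerivFwd ∕ covDeriv ∕ covLap`) and the [Balaban1985BackgroundPropagators] carrier of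
# the tree's Theorem 3.x files (the `Setup` torus `Site P 0`, def-Y's box chart `SiteY i`, letters `covD ∕ covDstar`, `cdS ∕ cdsS ∕ lapS`)

statement-level skeleton of published theorems with citation tags; proofs where landed; nothing here is a claim about the
Yang–Mills mass gap

T. Bałaban, *Propagators for lattice gauge theories in a background field*, Commun. Math. Phys. **99** (1985) 389–434
[`Balaban1985BackgroundPropagators`, "[B9]"]; T. Bałaban, *Spaces of regular gauge field configurations on a lattice and gauge fixing conditions*,
Commun. Math. Phys. **99** (1985) 75–102 [`Balaban1985RegularSpaces`, "[B8]"].  PDFs held (`paper:balaban1985-cmp99-background-propagators`,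
journal page = PDF page + 388; `paper:balaban1985-cmp99-regular-spaces-gauge-fixing`, journal page = PDF page + 74).

THE PRINT (verbatim).  [B8] p. 77: *«we admit the case where some domains Ω_j are equal to T_η»*; (1.1) p. 76: *«(D^η_{U,μ}F)(x) =
η⁻¹(R(U(x, x + ηe_μ))F(x + ηe_μ) − F(x)), (D^{η\*}_{U,μ}F)(x) = η⁻¹(R(U(x, x − ηe_μ))F(x − ηe_μ) − F(x))»*; [B9] (3.3) p. 390–391 and (3.8)
p. 392 (the same operators at `η`-lattice units), (3.23) p. 394: *«Δ^η_U = D^{η\*}_U D^η_U»*.  The two papers use ONE lattice `T_η`; the tree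
carries it twice: the [B8]-knit (cell `pub-ymgap` node N05, the consumers `B8Thm2TorusLetters.LettersAt` ∕ `B8SockLettersRD`) reads `T_η` as
`P`-PERIODIC data on `ℤᵈ` (`B8Thm4TorusAt`, `B8Thm2TorusAt`: «torus of `P` fine bonds per direction, read `P`-periodically on `ℤᵈ`»), the [B9]
files (def-Y's `Node00.OpsY*`, w1's `B9Thm31SiteCoerciveReg335Y`, p21's `B9Thm314*`) read it as the `Setup` torus `Site P 0 = Fin P.d → ZMod (2L^{m+K})`
and its box chart `SiteY i`.

CITATION HEADER (lean-in-tree rule).  Cell `lit-balaban`, sub-row G-B9-LETTERS, JUNCTION MODULE **J-A** of the lead's RULING #3 (2026-08-28T01:14Z,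
HOME∕INBOX: «J-A `B9B8CarrierDictionary` (G1: V1 box-chart carrier ↔ the knit's ℤᵈ∕torus-index carrier at torus members)» → seat `lit-balaban-p33`
gen 91; located joint J-CARRIER of `lit-balaban-p33/M53-STATEMENTS.md` §2 (G1)).  REUSED BY NAME, not restated: the periodic pullback machinery of
`B10Eq27TorusAxialLog` ∕ `B8Thm2SetupTorus` (`transl`, `rel`, `transl_add_e`, `transl_sub_e`, `transl_rel`, `transl_add_period`,
`pullGauge_descendGauge`), def-Y's chart lemma `Node00.OpsYGauge.boxEquiv_symm_shiftY`, the letters on both sides.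

WHAT THIS FILE PROVES (sorry-free; definitions with bodies = the two transfer maps; everything else theorems).
* §1 SITE FUNCTIONS: `liftFun Φ z := Φ(0 + z)` (torus function ↦ periodic `ℤᵈ` function) and `descFun f y := f(rel 0 y)`; `liftFun` is
  `2L^{m+K}`-periodic, `descFun ∘ liftFun = id`, `liftFun ∘ descFun = id` ON PERIODIC functions (`liftFun_descFun`), `liftFun` injective and
  `ℂ`-linear (`liftFunL`).
* §2 CONFIGURATIONS: `liftCfg U z μ := U μ (0 + z)` (def-Y's `CfgV1 P 𝔸` ↦ the knit's `Site d → Fin d → 𝔸ˣ`) and `descCfg`; periodicity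
  (`liftCfg_periodic`, the letter `shiftCfg (n • e i) U₀ = U₀` of `B8Thm2TorusAt.Thm2TorusAt`), the two round trips, `G`-valuedness both ways.
* §3 ★★ THE OPERATOR DICTIONARY, torus level, EXACT: `covDerivFwd η (liftCfg U) μ (liftFun Φ) z = η⁻¹ • covD (shiftsV1 P) U μ Φ (0 + z)`,
  `covDeriv … = η⁻¹ • covDstar …`, ★★ `covLap η (liftCfg U) (liftFun Φ) z = (η⁻¹·η⁻¹) • Σ_μ covDstar_μ(covD_μ Φ) (0 + z)` — [B8] (1.1)∕[B9] (3.23)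
  are ONE operator read on the two carriers (`B7Eq78Linearization.conjR = B9Eq39Adjoint.R` definitionally).
* §4 ★★ THE SAME THROUGH def-Y's BOX CHART: `cdS i U μ Φ (boxEquiv y) = covD (shiftsV1 _) U μ (Φ ∘ boxEquiv) y` (and `cdsS`, `lapS`), hence
  `covDerivFwd η (liftCfg U) μ (liftFun (Φ ∘ boxEquiv)) z = η⁻¹ • cdS i U μ Φ (boxEquiv (0 + z))` and
  ★★★ `covLap η (liftCfg U) (liftFun (Φ ∘ boxEquiv)) z = (η⁻¹·η⁻¹) • lapS i U Φ (boxEquiv (0 + z))` — the knit's covariant Laplacian of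
  (E3)∕`lapU_reads` IS `η⁻²`× def-Y's `lapS` (the Laplacian part of `deltaPrimeAY`, `Node00.OpsYDeltaPrimeA.lapSL`) on periodic functions.

HONEST SCOPE.  (i) Fine lattice only: sites, bonds-as-(site, direction), configurations, the three first∕second-order covariant operators.  NOT
here (J-A file 2 ∕ J-B): the block structure (`zdBlocking`∕`torusLam` ↔ `BlkY`∕`blkOf`), the averaging letters (`QprimeIter`∕`QT` vs `QpY`∕`QpsY` —
DIFFERENT operators at `U ≠ 1`, joint (G2)), the norms (`msup`∕`bondNorm`∕`Bd2` ↔ def-Y's), the regularity classes (`InAk` ↔ `Reg335`; cf.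
`B8Thm2SetupTorus.inSpace_univ_iff_inAk_pull` for the LQB torus class).  (ii) The dictionary transfers PERIODIC `ℤᵈ` functions only; the knit's
laws quantified over all `x : ℤᵈ → 𝔸` are the T-side re-keying question (G3) (t2s-1).  (iii) Carrier constraints inherited from `Setup`∕`KIdx`:
torus side `2L^{m+K}` per direction, `L` odd.  (iv) Bookkeeping only — no estimate of [B8]∕[B9] is proved or asserted; count-neutral; nothing
continuum, nothing about OS axioms or the mass gap.  No `sorry`, no `axiom`, no `instance`, no `notation`.  Seat `lit-balaban-p33` gen 91, 2026-08-28.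
-/

noncomputable section

namespace Literature.MathematicalPhysics.QuantumFieldTheory.Balaban1983to89.B9B8CarrierDictionary

open B7Prop1Explicit renaming Site → LSite
open B7Prop1Explicit (e)
open B7Eq78Linearization (conjR)
open B8Ineq132 (covDerivFwd covDeriv)
open B8Eq138LandauZd (covDivB covLap)
open B12Ineq417Flat (shiftCfg)
open B10Eq27TorusAxialLog (transl transl_apply transl_zero transl_add transl_add_e transl_sub_e transl_rel rel)
open B8Thm2SetupTorus (transl_add_period pullGauge descendGauge pullGauge_descendGauge)
open B9Eq39Adjoint (R covD covDstar)
open B9BackgroundsKLevelV1 (CfgV1 shiftsV1)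
open B6GlobalChartV1 (PV boxEquiv)
open B6KLevelCensusIndexV1 (KIdx)
open Node00

variable {P : Params}

/-! ## §1 Site functions: torus ↔ periodic `ℤᵈ` -/

section SiteFunctions

variable {β : Type*}

/-- **THE PERIODIC LIFT of a torus site function**: `(liftFun Φ)(z) = Φ(0 + z)` — the torus `T_η` read as periodic data on `ℤᵈ` ([B8] p. 77,
the knit's reading) from the base point `0`. [cite: Balaban1985RegularSpaces, p.77 («Ω_j = T_η»), (1.3) p.77; Balaban1987RG1, (0.1) p.251] -/
def liftFun (Φ : Site P 0 → β) : LSite P.d → β := fun z => Φ (transl 0 z)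

/-- the lift, evaluated. [cite: Balaban1985RegularSpaces, p.77, bookkeeping] -/
@[simp] theorem liftFun_apply (Φ : Site P 0 → β) (z : LSite P.d) : liftFun Φ z = Φ (transl 0 z) := rfl

/-- **THE DESCENT of a `ℤᵈ` function to the torus** along the section `rel 0` (least-absolute-value representatives): `(descFun f)(y) = f(y − 0)`.
[cite: Balaban1985RegularSpaces, p.77 («Ω_j = T_η»); Balaban1987RG1, (0.1) p.251] -/
def descFun (f : LSite P.d → β) : Site P 0 → β := fun y => f (rel 0 y)

/-- the descent, evaluated. [cite: Balaban1985RegularSpaces, p.77, bookkeeping] -/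
@[simp] theorem descFun_apply (f : LSite P.d → β) (y : Site P 0) : descFun f y = f (rel 0 y) := rfl

/-- ★ the lift is PERIODIC with the torus period `n = sitesPerDir 0` in every direction. [cite: Balaban1985RegularSpaces, (1.3) p.77, p.77 («Ω_j = T_η»)] -/
theorem liftFun_periodic (Φ : Site P 0 → β) (z : LSite P.d) (i : Fin P.d) :
    liftFun Φ (z + ((P.sitesPerDir 0 : ℕ) : ℤ) • e i) = liftFun Φ z := by
  rw [liftFun_apply, liftFun_apply, transl_add_period]

/-- the lift is periodic, `shiftCfg` form (the letter of `B8Thm2TorusAt.Thm2TorusAt`). [cite: Balaban1985RegularSpaces, (1.3) p.77] -/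
theorem shiftCfg_liftFun (Φ : Site P 0 → β) (i : Fin P.d) :
    shiftCfg (((P.sitesPerDir 0 : ℕ) : ℤ) • e i) (liftFun Φ) = liftFun Φ := by
  funext z
  rw [B12Ineq417Flat.shiftCfg_apply, liftFun_periodic]

/-- ★ descent ∘ lift = identity: a torus function is recovered from its periodic lift. [cite: Balaban1985RegularSpaces, p.77 («Ω_j = T_η»)] -/
theorem descFun_liftFun (Φ : Site P 0 → β) : descFun (liftFun Φ) = Φ := by
  funext y
  rw [descFun_apply, liftFun_apply, transl_rel]

/-- ★ lift ∘ descent = identity ON PERIODIC FUNCTIONS (`B8Thm2SetupTorus.pullGauge_descendGauge` read for site functions).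
[cite: Balaban1985RegularSpaces, (1.3) p.77, p.77 («Ω_j = T_η»)] -/
theorem liftFun_descFun {f : LSite P.d → β} (hf : ∀ (x : LSite P.d) (i : Fin P.d), f (x + ((P.sitesPerDir 0 : ℕ) : ℤ) • e i) = f x) :
    liftFun (descFun f) = f :=
  pullGauge_descendGauge (G := β) (0 : Site P 0) hf

/-- the lift is injective. [cite: Balaban1985RegularSpaces, p.77, bookkeeping] -/
theorem liftFun_injective : Function.Injective (liftFun : (Site P 0 → β) → LSite P.d → β) := fun Φ Ψ h => by
  rw [← descFun_liftFun Φ, ← descFun_liftFun Ψ, h]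

/-- a `ℤᵈ` function is a lift iff it is periodic. [cite: Balaban1985RegularSpaces, (1.3) p.77] -/
theorem exists_liftFun_eq_iff (f : LSite P.d → β) :
    (∃ Φ : Site P 0 → β, liftFun Φ = f) ↔ ∀ (x : LSite P.d) (i : Fin P.d), f (x + ((P.sitesPerDir 0 : ℕ) : ℤ) • e i) = f x := by
  constructor
  · rintro ⟨Φ, rfl⟩ x i
    exact liftFun_periodic Φ x i
  · intro hf
    exact ⟨descFun f, liftFun_descFun hf⟩

end SiteFunctions

section Linear

variable {𝔸 : Type} [NormedRing 𝔸] [NormedAlgebra ℂ 𝔸] [CompleteSpace 𝔸]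

omit [NormedAlgebra ℂ 𝔸] [CompleteSpace 𝔸] in
/-- the lift is additive. [cite: Balaban1985RegularSpaces, p.77, bookkeeping] -/
theorem liftFun_add (Φ Ψ : Site P 0 → 𝔸) : liftFun (Φ + Ψ) = liftFun Φ + liftFun Ψ := rfl

omit [CompleteSpace 𝔸] in
/-- the lift is homogeneous. [cite: Balaban1985RegularSpaces, p.77, bookkeeping] -/
theorem liftFun_smul (c : ℂ) (Φ : Site P 0 → 𝔸) : liftFun (c • Φ) = c • liftFun Φ := rfl

omit [NormedAlgebra ℂ 𝔸] [CompleteSpace 𝔸] in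
/-- the lift of `0` is `0`. [cite: Balaban1985RegularSpaces, p.77, bookkeeping] -/
theorem liftFun_zero : liftFun (0 : Site P 0 → 𝔸) = 0 := rfl

/-- **THE LIFT AS A `ℂ`-LINEAR MAP** (torus site functions ↪ `ℤᵈ` site functions). [cite: Balaban1985RegularSpaces, p.77 («Ω_j = T_η»)] -/
def liftFunL (P : Params) : (Site P 0 → 𝔸) →ₗ[ℂ] (LSite P.d → 𝔸) where
  toFun := liftFun
  map_add' := liftFun_add
  map_smul' := liftFun_smul

omit [CompleteSpace 𝔸] in
/-- `liftFunL` is `liftFun`. [cite: Balaban1985RegularSpaces, p.77, bookkeeping] -/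
@[simp] theorem liftFunL_apply (Φ : Site P 0 → 𝔸) : liftFunL P Φ = liftFun Φ := rfl

end Linear

/-! ## §2 Configurations: def-Y's `CfgV1` ↔ the knit's `Site d → Fin d → 𝔸ˣ` -/

section Configurations

variable {𝔸 : Type} [Ring 𝔸]

/-- **THE PERIODIC LIFT OF A TORUS CONFIGURATION** `U : CfgV1 P 𝔸` (`U μ x = U(x, x + e_μ)`) to the knit's carrier: `(liftCfg U) z μ = U μ (0 + z)`.
[cite: Balaban1985RegularSpaces, p.77 («Ω_j = T_η»), (1.3) p.77; Balaban1985BackgroundPropagators, Sect. A p.390 («U = {U(x, x′)} defined on bonds of T_η»)] -/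
def liftCfg (U : CfgV1 P 𝔸) : LSite P.d → Fin P.d → 𝔸ˣ := fun z μ => U μ (transl 0 z)

/-- the lifted configuration, evaluated. [cite: Balaban1985RegularSpaces, p.77, bookkeeping] -/
@[simp] theorem liftCfg_apply (U : CfgV1 P 𝔸) (z : LSite P.d) (μ : Fin P.d) : liftCfg U z μ = U μ (transl 0 z) := rfl

/-- **THE DESCENT OF A `ℤᵈ` CONFIGURATION** to def-Y's carrier along `rel 0`. [cite: Balaban1985RegularSpaces, p.77 («Ω_j = T_η»)] -/
def descCfg (U₀ : LSite P.d → Fin P.d → 𝔸ˣ) : CfgV1 P 𝔸 := fun μ y => U₀ (rel 0 y) μ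

/-- the descended configuration, evaluated. [cite: Balaban1985RegularSpaces, p.77, bookkeeping] -/
@[simp] theorem descCfg_apply (U₀ : LSite P.d → Fin P.d → 𝔸ˣ) (μ : Fin P.d) (y : Site P 0) : descCfg (P := P) U₀ μ y = U₀ (rel 0 y) μ := rfl

/-- ★ the lifted configuration is PERIODIC (the letter `shiftCfg (n • e i) U₀ = U₀` of `B8Thm2TorusAt.Thm2TorusAt`).
[cite: Balaban1985RegularSpaces, (1.3) p.77, p.77 («Ω_j = T_η»)] -/
theorem liftCfg_periodic (U : CfgV1 P 𝔸) (i : Fin P.d) :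
    shiftCfg (((P.sitesPerDir 0 : ℕ) : ℤ) • e i) (liftCfg U) = liftCfg U := by
  funext z μ
  rw [B12Ineq417Flat.shiftCfg_apply, liftCfg_apply, liftCfg_apply, transl_add_period]

/-- ★ descent ∘ lift = identity on torus configurations. [cite: Balaban1985RegularSpaces, p.77 («Ω_j = T_η»)] -/
theorem descCfg_liftCfg (U : CfgV1 P 𝔸) : descCfg (liftCfg U) = U := by
  funext μ y
  rw [descCfg_apply, liftCfg_apply, transl_rel]

/-- ★ lift ∘ descent = identity ON PERIODIC `ℤᵈ` configurations. [cite: Balaban1985RegularSpaces, (1.3) p.77] -/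
theorem liftCfg_descCfg {U₀ : LSite P.d → Fin P.d → 𝔸ˣ} (hU₀ : ∀ i : Fin P.d, shiftCfg (((P.sitesPerDir 0 : ℕ) : ℤ) • e i) U₀ = U₀) :
    liftCfg (descCfg (P := P) U₀) = U₀ := by
  have hper : ∀ (x : LSite P.d) (i : Fin P.d), U₀ (x + ((P.sitesPerDir 0 : ℕ) : ℤ) • e i) = U₀ x := fun x i => by
    have h := congrFun (hU₀ i) x
    rwa [B12Ineq417Flat.shiftCfg_apply] at h
  have h := liftFun_descFun (β := Fin P.d → 𝔸ˣ) hper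
  funext z μ
  have hz := congrFun h z
  rw [liftFun_apply, descFun_apply] at hz
  rw [liftCfg_apply, descCfg_apply]
  exact congrFun hz μ

/-- `G`-valuedness transfers to the lift. [cite: Balaban1985BackgroundPropagators, p.390 («with values in G»)] -/
theorem liftCfg_mem {G : Subgroup 𝔸ˣ} {U : CfgV1 P 𝔸} (hU : ∀ μ x, U μ x ∈ G) (z : LSite P.d) (μ : Fin P.d) : liftCfg U z μ ∈ G :=
  hU μ _

/-- `G`-valuedness transfers to the descent. [cite: Balaban1985BackgroundPropagators, p.390 («with values in G»)] -/
theorem descCfg_mem {G : Subgroup 𝔸ˣ} {U₀ : LSite P.d → Fin P.d → 𝔸ˣ} (hU₀ : ∀ z μ, U₀ z μ ∈ G) (μ : Fin P.d) (y : Site P 0) :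
    descCfg (P := P) U₀ μ y ∈ G :=
  hU₀ _ μ

/-- `G`-valuedness of a torus configuration is EQUIVALENT to that of its lift. [cite: Balaban1985BackgroundPropagators, p.390 («with values in G»)] -/
theorem liftCfg_mem_iff {G : Subgroup 𝔸ˣ} (U : CfgV1 P 𝔸) : (∀ z μ, liftCfg U z μ ∈ G) ↔ ∀ μ x, U μ x ∈ G := by
  refine ⟨fun h μ x => ?_, fun h z μ => liftCfg_mem h z μ⟩
  have h' := h (rel 0 x) μ
  rwa [liftCfg_apply, transl_rel] at h'

end Configurations

/-! ## §3 The operator dictionary at torus level: [B8] (1.1) ∕ [B9] (3.3), (3.8), (3.23) are one operator on two carriers -/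

section Operators

variable {𝔸 : Type} [NormedRing 𝔸] [NormedAlgebra ℂ 𝔸] [CompleteSpace 𝔸]

omit [NormedAlgebra ℂ 𝔸] [CompleteSpace 𝔸] in
/-- the two adjoint-action letters agree: `B7Eq78Linearization.conjR = B9Eq39Adjoint.R`. [cite: Balaban1985Averaging, (56) p.27; Balaban1985BackgroundPropagators, p.390] -/
theorem conjR_eq_R (X : 𝔸ˣ) (Y : 𝔸) : conjR X Y = R X Y := rfl

omit [NormedAlgebra ℂ 𝔸] [CompleteSpace 𝔸] in
/-- the `Setup` torus shift is def-Y's shift permutation: `shiftsV1 P μ x = x + e_μ`. [cite: Balaban1985BackgroundPropagators, (3.3) p.391, bookkeeping] -/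
theorem shiftsV1_apply (μ : Fin P.d) (x : Site P 0) : shiftsV1 P μ x = x.shift μ := rfl

omit [NormedAlgebra ℂ 𝔸] [CompleteSpace 𝔸] in
/-- … and its inverse is `x ↦ x − e_μ`. [cite: Balaban1985BackgroundPropagators, (3.8) p.392, bookkeeping] -/
theorem shiftsV1_symm_apply (μ : Fin P.d) (x : Site P 0) : (shiftsV1 P μ).symm x = x.unshift μ := rfl

omit [CompleteSpace 𝔸] in
/-- ★★ **[B8] (1.1)₁ IS [B9] (3.3) ON THE LIFT**: `(D^η_{U₀,μ} f♯)(z) = η⁻¹·(∇_{U,μ}Φ)(0 + z)` for `U₀ = liftCfg U`, `f♯ = liftFun Φ`.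
[cite: Balaban1985RegularSpaces, (1.1) p.76; Balaban1985BackgroundPropagators, (3.3) pp.390–391] -/
theorem covDerivFwd_liftFun (η : ℝ) (U : CfgV1 P 𝔸) (μ : Fin P.d) (Φ : Site P 0 → 𝔸) (z : LSite P.d) :
    covDerivFwd η (liftCfg U) μ (liftFun Φ) z = η⁻¹ • covD (shiftsV1 P) U μ Φ (transl 0 z) := by
  unfold covDerivFwd covD
  rw [liftFun_apply, liftFun_apply, liftCfg_apply, transl_add_e, conjR_eq_R, shiftsV1_apply]

omit [CompleteSpace 𝔸] in
/-- ★★ **[B8] (1.1)₂ IS [B9] (3.8)'s `∇*_{U,μ}` ON THE LIFT**: `(D^{η*}_{U₀,μ} f♯)(z) = η⁻¹·(∇*_{U,μ}Φ)(0 + z)`.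
[cite: Balaban1985RegularSpaces, (1.1) p.76; Balaban1985BackgroundPropagators, (3.8) p.392] -/
theorem covDeriv_liftFun (η : ℝ) (U : CfgV1 P 𝔸) (μ : Fin P.d) (Φ : Site P 0 → 𝔸) (z : LSite P.d) :
    covDeriv η (liftCfg U) μ (liftFun Φ) z = η⁻¹ • covDstar (shiftsV1 P) U μ Φ (transl 0 z) := by
  unfold covDeriv covDstar
  rw [liftFun_apply, liftFun_apply, liftCfg_apply, transl_sub_e, conjR_eq_R, shiftsV1_symm_apply]

omit [CompleteSpace 𝔸] in
/-- `∇*_{U,μ}` is `ℂ`-homogeneous (bookkeeping for the `η`-scaling of the Laplacian). [cite: Balaban1985BackgroundPropagators, (3.8) p.392, bookkeeping] -/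
theorem covDstar_smul {S ι : Type*} (T : ι → Equiv.Perm S) (U : ι → S → 𝔸ˣ) (μ : ι) (c : ℂ) (G : S → 𝔸) (x : S) :
    covDstar T U μ (c • G) x = c • covDstar T U μ G x := by
  unfold covDstar
  rw [Pi.smul_apply, Pi.smul_apply, B9Eq39Adjoint.R_smul, smul_sub]

omit [CompleteSpace 𝔸] in
/-- the real scalar `η⁻¹` acts through `ℂ`. [folklore] -/
private theorem real_smul_eq_coe_smul (r : ℝ) (X : 𝔸) : r • X = ((r : ℂ)) • X := by
  rw [Complex.coe_smul]

omit [CompleteSpace 𝔸] in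
/-- ★★★ **[B9] (3.23) `Δ^η_U = D^{η*}_U D^η_U` ON THE TWO CARRIERS**: the knit's `covLap η U₀` of a periodic lift is `η⁻²` times the torus
operator `Σ_μ ∇*_{U,μ}∇_{U,μ}` (lattice units) read at `0 + z`. [cite: Balaban1985BackgroundPropagators, (3.23) p.394; Balaban1985RegularSpaces, (1.1) p.76, (1.38) p.82] -/
theorem covLap_liftFun (η : ℝ) (U : CfgV1 P 𝔸) (Φ : Site P 0 → 𝔸) (z : LSite P.d) :
    covLap η (liftCfg U) (liftFun Φ) z =
      (η⁻¹ * η⁻¹) • ∑ μ : Fin P.d, covDstar (shiftsV1 P) U μ (covD (shiftsV1 P) U μ Φ) (transl 0 z) := by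
  unfold covLap covDivB
  rw [Finset.smul_sum]
  refine Finset.sum_congr rfl fun μ _ => ?_
  -- the inner forward derivative is the lift of `η⁻¹ • ∇_{U,μ}Φ`
  have hinner : (fun x => covDerivFwd η (liftCfg U) μ (liftFun Φ) x) =
      liftFun (((η⁻¹ : ℝ) : ℂ) • covD (shiftsV1 P) U μ Φ) := by
    funext x
    rw [covDerivFwd_liftFun, liftFun_apply, Pi.smul_apply, real_smul_eq_coe_smul]
  rw [hinner, covDeriv_liftFun, covDstar_smul, real_smul_eq_coe_smul, real_smul_eq_coe_smul, smul_smul, Complex.ofReal_mul]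

end Operators

/-! ## §4 The same identities through def-Y's box chart `SiteY i` (the carrier of `Node00.OpsY*`, w1, p21) -/

section BoxChart

variable {d ℓ : ℕ} {hd : 1 ≤ d + 1} {hL : Odd (ℓ + 1) ∧ 1 < ℓ + 1} {b₀ b₁ : ℝ}
variable {𝔸 : Type} [NormedRing 𝔸] [NormedAlgebra ℂ 𝔸] [CompleteSpace 𝔸]
variable (i : KIdx d ℓ hd hL b₀ b₁)

/-- def-Y's box-chart shift IS the torus shift: `shiftY μ (boxEquiv y) = boxEquiv (y + e_μ)` (`Node00.OpsYGauge.boxEquiv_symm_shiftY` inverted).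
[cite: Balaban1984PropagatorsII, (2.1) p.224, dictionary; Balaban1985BackgroundPropagators, (3.3) p.391] -/
theorem shiftY_boxEquiv (μ : Fin (d + 1)) (y : Site (PV d ℓ i.m i.K hd hL) 0) :
    shiftY i μ (boxEquiv i.hN y) = boxEquiv i.hN (y.shift μ) := by
  apply (boxEquiv i.hN).symm.injective
  rw [boxEquiv_symm_shiftY, Equiv.symm_apply_apply, Equiv.symm_apply_apply]

/-- … and for the inverse shift: `shiftY μ⁻¹ (boxEquiv y) = boxEquiv (y − e_μ)`. [cite: Balaban1984PropagatorsII, (2.1) p.224, dictionary; Balaban1985BackgroundPropagators, (3.8) p.392] -/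
theorem shiftY_symm_boxEquiv (μ : Fin (d + 1)) (y : Site (PV d ℓ i.m i.K hd hL) 0) :
    (shiftY i μ).symm (boxEquiv i.hN y) = boxEquiv i.hN (y.unshift μ) := by
  apply (shiftY i μ).injective
  rw [Equiv.apply_symm_apply, shiftY_boxEquiv]
  congr 1
  exact ((shiftsV1 (PV d ℓ i.m i.K hd hL) μ).apply_symm_apply y).symm

/-- ★ def-Y's `∇_{U,μ}` on the box chart IS the torus-level `covD` read through `boxEquiv`. [cite: Balaban1985BackgroundPropagators, (3.3) pp.390–391] -/
theorem cdS_boxEquiv (U : CfgY 𝔸 i) (μ : Fin (d + 1)) (Φ : SiteY i → 𝔸) (y : Site (PV d ℓ i.m i.K hd hL) 0) :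
    cdS i U μ Φ (boxEquiv i.hN y) = covD (shiftsV1 (PV d ℓ i.m i.K hd hL)) U μ (Φ ∘ boxEquiv i.hN) y := by
  unfold cdS covD UboxY
  rw [shiftY_boxEquiv, Equiv.symm_apply_apply, Function.comp_apply, Function.comp_apply, shiftsV1_apply]

/-- ★ def-Y's `∇*_{U,μ}` on the box chart IS the torus-level `covDstar` read through `boxEquiv`. [cite: Balaban1985BackgroundPropagators, (3.8) p.392] -/
theorem cdsS_boxEquiv (U : CfgY 𝔸 i) (μ : Fin (d + 1)) (G : SiteY i → 𝔸) (y : Site (PV d ℓ i.m i.K hd hL) 0) :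
    cdsS i U μ G (boxEquiv i.hN y) = covDstar (shiftsV1 (PV d ℓ i.m i.K hd hL)) U μ (G ∘ boxEquiv i.hN) y := by
  unfold cdsS covDstar UboxY
  rw [shiftY_symm_boxEquiv, Equiv.symm_apply_apply, Function.comp_apply, Function.comp_apply, shiftsV1_symm_apply]

/-- ★ def-Y's site Laplacian `lapS` on the box chart IS the torus-level `Σ_μ ∇*_{U,μ}∇_{U,μ}` read through `boxEquiv`.
[cite: Balaban1985BackgroundPropagators, (3.23) p.394] -/
theorem lapS_boxEquiv (U : CfgY 𝔸 i) (Φ : SiteY i → 𝔸) (y : Site (PV d ℓ i.m i.K hd hL) 0) :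
    lapS i U Φ (boxEquiv i.hN y) =
      ∑ μ : Fin (d + 1), covDstar (shiftsV1 (PV d ℓ i.m i.K hd hL)) U μ
        (covD (shiftsV1 (PV d ℓ i.m i.K hd hL)) U μ (Φ ∘ boxEquiv i.hN)) y := by
  unfold lapS
  refine Finset.sum_congr rfl fun μ _ => ?_
  rw [cdsS_boxEquiv]
  congr 1
  funext x
  rw [Function.comp_apply, cdS_boxEquiv]

/-- ★★ **THE KNIT's `D^η_{U₀,μ}` OF A LIFTED BOX-CHART FUNCTION IS `η⁻¹`× def-Y's `cdS`** at the charted point.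
[cite: Balaban1985RegularSpaces, (1.1) p.76; Balaban1985BackgroundPropagators, (3.3) pp.390–391] -/
theorem covDerivFwd_liftY (η : ℝ) (U : CfgY 𝔸 i) (μ : Fin (d + 1)) (Φ : SiteY i → 𝔸) (z : LSite (d + 1)) :
    covDerivFwd η (liftCfg U) μ (liftFun (Φ ∘ boxEquiv i.hN)) z = η⁻¹ • cdS i U μ Φ (boxEquiv i.hN (transl 0 z)) := by
  rw [covDerivFwd_liftFun, cdS_boxEquiv]

/-- ★★ **THE KNIT's `D^{η*}_{U₀,μ}` OF A LIFTED BOX-CHART FUNCTION IS `η⁻¹`× def-Y's `cdsS`**. [cite: Balaban1985RegularSpaces, (1.1) p.76; Balaban1985BackgroundPropagators, (3.8) p.392] -/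
theorem covDeriv_liftY (η : ℝ) (U : CfgY 𝔸 i) (μ : Fin (d + 1)) (G : SiteY i → 𝔸) (z : LSite (d + 1)) :
    covDeriv η (liftCfg U) μ (liftFun (G ∘ boxEquiv i.hN)) z = η⁻¹ • cdsS i U μ G (boxEquiv i.hN (transl 0 z)) := by
  rw [covDeriv_liftFun, cdsS_boxEquiv]

/-- ★★★ **THE KNIT's COVARIANT LAPLACIAN `covLap η U₀` ((E3) `lapU_reads` of `B8Thm2TorusLetters.LettersAt`, `B8SockLettersRD`) OF A LIFTED
BOX-CHART FUNCTION IS `η⁻²`× def-Y's `lapS`** (the Laplacian part of `Node00.OpsYDeltaPrimeA.deltaPrimeAY`), at every site, for every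
torus background — the fine-lattice half of joint J-CARRIER, exact. [cite: Balaban1985BackgroundPropagators, (3.23) p.394; Balaban1985RegularSpaces, (1.1) p.76, (1.38) p.82] -/
theorem covLap_liftY (η : ℝ) (U : CfgY 𝔸 i) (Φ : SiteY i → 𝔸) (z : LSite (d + 1)) :
    covLap η (liftCfg U) (liftFun (Φ ∘ boxEquiv i.hN)) z = (η⁻¹ * η⁻¹) • lapS i U Φ (boxEquiv i.hN (transl 0 z)) := by
  rw [covLap_liftFun, lapS_boxEquiv]

/-- the same for def-Y's `ℂ`-linear Laplacian letter `lapSL` (`Node00.OpsYDeltaPrimeA`). [cite: Balaban1985BackgroundPropagators, (3.23)–(3.24) p.394] -/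
theorem covLap_liftY_lapSL (η : ℝ) (U : CfgY 𝔸 i) (Φ : SiteY i → 𝔸) (z : LSite (d + 1)) :
    covLap η (liftCfg U) (liftFun (Φ ∘ boxEquiv i.hN)) z = (η⁻¹ * η⁻¹) • lapSL i U Φ (boxEquiv i.hN (transl 0 z)) := by
  rw [covLap_liftY]
  rfl

end BoxChart

end Literature.MathematicalPhysics.QuantumFieldTheory.Balaban1983to89.B9B8CarrierDictionary

end
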